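import Mathlib
import Summits.Ventures.PercRepro2.LocRows
import Summits.Ventures.PercRepro2.SwRow
import Summits.Ventures.PercRepro2.SwOut
import Summits.Ventures.PercRepro2.SwAllRow
import Summits.Ventures.PercRepro2.SwOutAll
import Summits.Ventures.PercRepro2.SwOutReducible
import Summits.Ventures.PercRepro2.SwOutJunction
import Summits.Ventures.PercRepro2.SwOutJunctionRegion
import Summits.Ventures.PercRepro2.SwOutJunctionSw
import Summits.Ventures.PercRepro2.SwOutJunctionH1Defs
import Summits.Ventures.PercRepro2.SwOutJunctionH1Key

/-!
# Row (SW) on every graph with one (H1) junction (blind cell PercRepro2, night-4 g14,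
2026-08-26; proofs/NIGHT4-G12.md §3 COROLLARIES, proofs/NIGHT4-G14.md §6)

Theorem A (`rigidOK_of_junctionH1`) makes every (H1) single-junction region a base region of the
series reduction (`reducible_of_junctionH1`); with the region `{l}ᶜ` this is the rigid row
2′SW-ALL (`swAll_of_junctionH1`) and row (SW) (`sw_of_junctionH1`) on every graph in which every
vertex other than `l, h, o` is joined to `l` or is one vertex `u ∉ N(l) ∪ N(h)` whose neighbours
satisfy the simple-arm hypothesis (H1) in `U = V ∖ {l}` — the (H1) version of `sw_of_junction`
(which needs every neighbour of `u` adjacent to `h`).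
-/

namespace Summit.Ventures.PercRepro2

namespace LocRows

open Hull

variable {V : Type*} {E : Type*} [Fintype E] [DecidableEq E]

open scoped Classical

variable {ends : E → Sym2 V} {l h o u : V}

/-- A region with one (H1) junction is a base region of the series reduction. -/
theorem reducible_of_junctionH1 {U : Set V} (hl : l ∉ U) (hloop_h : ∀ e, ends e ≠ s(h, h))
    (hloop_u : ∀ e, ends e ≠ s(u, u)) (hhu : h ≠ u) (hnadj : ∀ e, ends e ≠ s(h, u))
    (hout : ∀ x ∈ U, x ≠ h → x ≠ o → x ≠ u →
      (∃ e y, ends e = s(x, y) ∧ y ∉ U) ∨ (∀ e, x ∉ ends e))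
    (hH1 : H1 ends U h u) : Reducible l h o ends U :=
  Reducible.base ends U fun ξ =>
    rigidOK_of_junctionH1 (ξ := ξ) hl hhu hloop_h hloop_u hnadj hout hH1

/-- **Row 2′SW-ALL on every graph with one (H1) junction**: every vertex other than `l, h, o, u`
is joined to `l`, `u ≠ l`, no loop at `h` or `u`, `u` not adjacent to `h`, and (H1) in `{l}ᶜ`. -/
theorem swAll_of_junctionH1 (hlh : l ≠ h) (hloop_h : ∀ e, ends e ≠ s(h, h))
    (hloop_u : ∀ e, ends e ≠ s(u, u)) (hhu : h ≠ u) (hnadj : ∀ e, ends e ≠ s(h, u))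
    (hH1 : H1 ends ({l}ᶜ) h u)
    (hjoin : ∀ x, x ≠ l → x ≠ h → x ≠ o → x ≠ u → ∃ e, ends e = s(x, l)) : SwAll ends l h o := by
  refine swAll_of_reducible l h o hlh
    (reducible_of_junctionH1 (by simp) hloop_h hloop_u hhu hnadj ?_ hH1)
  intro x hx hxh hxo hxu
  obtain ⟨e, he⟩ := hjoin x (by simpa using hx) hxh hxo hxu
  exact Or.inl ⟨e, l, he, by simp⟩

/-- **Row (SW) on every graph with one (H1) junction** (see `swAll_of_junctionH1`). -/
theorem sw_of_junctionH1 (hlh : l ≠ h) (hloop_h : ∀ e, ends e ≠ s(h, h))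
    (hloop_u : ∀ e, ends e ≠ s(u, u)) (hhu : h ≠ u) (hnadj : ∀ e, ends e ≠ s(h, u))
    (hH1 : H1 ends ({l}ᶜ) h u)
    (hjoin : ∀ x, x ≠ l → x ≠ h → x ≠ o → x ≠ u → ∃ e, ends e = s(x, l)) : Sw ends l h o :=
  sw_of_swAll ends (swAll_of_junctionH1 hlh hloop_h hloop_u hhu hnadj hH1 hjoin)

end LocRows

end Summit.Ventures.PercRepro2
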